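import Literature.NumberTheory.EllipticCurves.CMSqrtEndomorphism
import Literature.NumberTheory.EllipticCurves.ComplexMultiplicationDeuringReductionMapProofs
import Literature.NumberTheory.GaloisRepresentations.AbsGaloisGroup
import HarnessLib

set_option linter.dupNamespace false -- `Summit.BirchSwinnertonDyer.BirchSwinnertonDyer.Theorems.…` (summit = sub)
set_option autoImplicit false

/-!
# Crux `EisensteinHeartFlatCMInertBadKPrime` (stmt-BirchSwinnertonDyer-21341), line `hsieh-lambda`, layer 2 — the CM endomorphism `[√d]`
# on `E(F̄)` over a base field `F ∌ √d`, in GALOIS-ACTION form: `σ ∘ [√d] = ±[√d] ∘ σ` by the sign `σ(√d)/√d`, and `[√d]² = [d]`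

Route `BiquadraticEisensteinDescent` (cell `pub/bsd-wall`, width-prover seat `bsd-wall-cm-bed-w1` g5). The tree's
`Literature.NumberTheory.EllipticCurves.CMSqrtEndomorphism` constructs `[√d] = τ ∘ φ` (Silverman, *Advanced Topics*, II §2, Prop. II.2.3.1)
from an isogeny formula `φ : W → W^{(d)}` with twisting data (`IsogenyFormula.IsTwistBy`) over a field CONTAINING `r = √d`, as an ISOGENY over
that field, with `[√d] ∘ [√d] = [-deg U]` (`sqrtEndo_comp_self`) and the anti-commutation `σ ∘ [√d] = -[√d] ∘ σ` for a ring automorphism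
`σ` of the algebraic closure with `σ r = -r` (`mapPoint_sqrtEndo`). The V3 socket of this crux (`…CMDatumAdapter.heartShape_xac_of_sqrt_endomorphism`)
needs `[√d]` over a base field `F = K′` that does NOT contain `√d`, as an additive endomorphism `ψ` of `E(F̄)` together with its behaviour
under the absolute Galois group `Γ_F`: `σ • ψ P = ψ (σ • P)` if `σ r = r` and `σ • ψ P = -ψ (σ • P)` if `σ r = -r` (`r = √d ∈ F̄`). This file
derives exactly that from the tree's theorems, by reading them over the base field `Ω = F̄` (which contains `r`) and transporting along the
bijection `β : E(F̄) ≃ E_{F̄}(\overline{F̄})` (`WeierstrassCurve.geomPointsBaseChangeEquiv`), each `σ ∈ Γ_F` being lifted to a ring automorphism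
of `\overline{F̄}` (`IsAlgClosure.equivOfEquiv`):

* §1 `isTwistBy_map` (twisting data survive base change); §2 `exists_ringEquiv_lift`, `map_baseChange_baseChange_eq`, `map_map_map_eq`
  (lifting `σ` and invariance of `F`-rational coefficients); §3 `geomPointsBaseChangeEquiv_smul` (`β (σ • P) = σ̃ (β P)`);
  §4 `smul_comm_of_forall_smul_anticomm` (commutation on `Stab(r)` from anti-commutation off it, given ONE `σ₀` with `σ₀ r = -r`);
* §5 **`exists_sqrt_endomorphism`**: for `φ : IsogenyFormula W W′` over `F` (characteristic `0`, `W` elliptic) with `φ.IsTwistBy d`, `U, h` coprime,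
  `r ∈ F̄` with `r² = d`, and some `σ₀ ∈ Γ_F` with `σ₀ r = -r`: an additive `ψ` on `E(F̄)` with the two Galois rules above and
  `ψ (ψ P) = -(deg U) • P`.

THEOREMS ONLY (no definition, no named fact, no instance, no `sorry`); generic in `F`; nothing about V2/V4 or any case of BSD is asserted;
BSD is not proved by any of this. Supports stmt-BirchSwinnertonDyer-21341 as a helper.

References: [SilvermanAdvancedTopics1994] II §2, Prop. II.2.3.1, Thm. II.2.2(b), Example II.2.3.2; [SilvermanAEC2009] III.4.8, Cor. III.6.3, X.5.
-/

noncomputable section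

open scoped Classical

universe u

namespace Summit.BirchSwinnertonDyer.BirchSwinnertonDyer.Theorems.BiquadraticEisensteinDescentEisensteinHeartFlatCMInertBadKPrimeSqrtEndomorphism

open Polynomial WeierstrassCurve WeierstrassCurve.IsogenyFormula Field

/-! ## §1 Twisting data survive base change -/

section TwistMap

variable {R A : Type*} [CommRing R] [CommRing A] {W W' : WeierstrassCurve R}

/-- The twisting data `IsTwistBy` of a formula are preserved by an injective base change. [cite: SilvermanAEC2009, X.5 (twists)] -/
theorem isTwistBy_map (φ : IsogenyFormula W W') {d : R} (H : φ.IsTwistBy d) (f : R →+* A) (hf : Function.Injective f) :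
    (φ.map f hf).IsTwistBy (f d) where
  a₁ := by rw [map_a₁, H.a₁, map_zero]
  a₂ := by rw [map_a₂, H.a₂, map_zero]
  a₃ := by rw [map_a₃, H.a₃, map_zero]
  a₁' := by rw [map_a₁, H.a₁', map_zero]
  a₂' := by rw [map_a₂, H.a₂', map_zero]
  a₃' := by rw [map_a₃, H.a₃', map_zero]
  a₄' := by rw [map_a₄, map_a₄, H.a₄', map_mul, map_pow]
  a₆' := by rw [map_a₆, map_a₆, H.a₆', map_mul, map_pow]
  T := by rw [map_T, H.T, Polynomial.map_zero]

end TwistMap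

/-! ## §2 Lifting `Γ_F` to `\overline{F̄}` and invariance of `F`-rational data -/

section Lift

variable {F : Type u} [Field F]

/-- Every `σ ∈ Γ_F` lifts to a ring automorphism `σ̃` of `\overline{F̄}` with `σ̃ ∘ ι = ι ∘ σ` (`ι : F̄ → \overline{F̄}`), by the uniqueness
of algebraic closures (Mathlib `IsAlgClosure.equivOfEquiv`). [folklore] -/
theorem exists_ringEquiv_lift (σ : absoluteGaloisGroup F) :
    ∃ σ' : AlgebraicClosure (AlgebraicClosure F) ≃+* AlgebraicClosure (AlgebraicClosure F),
      ∀ x : AlgebraicClosure F, σ' (algebraMap (AlgebraicClosure F) (AlgebraicClosure (AlgebraicClosure F)) x) =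
        algebraMap (AlgebraicClosure F) (AlgebraicClosure (AlgebraicClosure F)) (σ • x) :=
  ⟨IsAlgClosure.equivOfEquiv (AlgebraicClosure (AlgebraicClosure F)) (AlgebraicClosure (AlgebraicClosure F))
      (absoluteGaloisGroup.toAlgEquiv F σ).toRingEquiv,
    fun x ↦ by rw [IsAlgClosure.equivOfEquiv_algebraMap]; rfl⟩

/-- The composite `F → F̄ → \overline{F̄}` is fixed by the lift `σ̃` of any `σ ∈ Γ_F`. [folklore] -/
theorem lift_comp_algebraMap_eq (σ : absoluteGaloisGroup F)
    (σ' : AlgebraicClosure (AlgebraicClosure F) ≃+* AlgebraicClosure (AlgebraicClosure F))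
    (hσ' : ∀ x : AlgebraicClosure F, σ' (algebraMap (AlgebraicClosure F) (AlgebraicClosure (AlgebraicClosure F)) x) =
      algebraMap (AlgebraicClosure F) (AlgebraicClosure (AlgebraicClosure F)) (σ • x)) :
    (σ'.toRingHom.comp (algebraMap (AlgebraicClosure F) (AlgebraicClosure (AlgebraicClosure F)))).comp
        (algebraMap F (AlgebraicClosure F)) =
      (algebraMap (AlgebraicClosure F) (AlgebraicClosure (AlgebraicClosure F))).comp (algebraMap F (AlgebraicClosure F)) := by
  ext x
  simp only [RingHom.comp_apply, RingEquiv.toRingHom_eq_coe, RingHom.coe_coe, hσ', smul_algebraMap]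

/-- `σ̃` fixes the equation of `E_{F̄} ⊗ \overline{F̄}` for `E` defined over `F`. [folklore] -/
theorem map_baseChange_baseChange_eq (W : WeierstrassCurve F) (σ : absoluteGaloisGroup F)
    (σ' : AlgebraicClosure (AlgebraicClosure F) ≃+* AlgebraicClosure (AlgebraicClosure F))
    (hσ' : ∀ x : AlgebraicClosure F, σ' (algebraMap (AlgebraicClosure F) (AlgebraicClosure (AlgebraicClosure F)) x) =
      algebraMap (AlgebraicClosure F) (AlgebraicClosure (AlgebraicClosure F)) (σ • x)) :
    ((W.baseChange (AlgebraicClosure F)).baseChange (AlgebraicClosure (AlgebraicClosure F))).map σ'.toRingHom =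
      (W.baseChange (AlgebraicClosure F)).baseChange (AlgebraicClosure (AlgebraicClosure F)) := by
  simp only [WeierstrassCurve.baseChange, WeierstrassCurve.map_map]
  rw [← RingHom.comp_assoc, lift_comp_algebraMap_eq σ σ' hσ']

/-- `σ̃` fixes an `F`-rational polynomial read in `\overline{F̄}`. [folklore] -/
theorem map_map_map_eq (q : F[X]) (σ : absoluteGaloisGroup F)
    (σ' : AlgebraicClosure (AlgebraicClosure F) ≃+* AlgebraicClosure (AlgebraicClosure F))
    (hσ' : ∀ x : AlgebraicClosure F, σ' (algebraMap (AlgebraicClosure F) (AlgebraicClosure (AlgebraicClosure F)) x) =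
      algebraMap (AlgebraicClosure F) (AlgebraicClosure (AlgebraicClosure F)) (σ • x)) :
    ((q.map (algebraMap F (AlgebraicClosure F))).map
        (algebraMap (AlgebraicClosure F) (AlgebraicClosure (AlgebraicClosure F)))).map σ'.toRingHom =
      (q.map (algebraMap F (AlgebraicClosure F))).map (algebraMap (AlgebraicClosure F) (AlgebraicClosure (AlgebraicClosure F))) := by
  simp only [Polynomial.map_map]
  rw [← RingHom.comp_assoc, lift_comp_algebraMap_eq σ σ' hσ']

end Lift

/-! ## §3 `β (σ • P) = σ̃ (β P)` for the base change of points `β : E(F̄) ≃ E_{F̄}(\overline{F̄})` -/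

section Beta

variable {F : Type u} [Field F] (W : WeierstrassCurve F)

/-- The Galois action on `E(F̄)` corresponds under `β` to the coordinate action of the lift `σ̃`. [folklore] -/
theorem geomPointsBaseChangeEquiv_smul (σ : absoluteGaloisGroup F)
    (σ' : AlgebraicClosure (AlgebraicClosure F) ≃+* AlgebraicClosure (AlgebraicClosure F))
    (hσ' : ∀ x : AlgebraicClosure F, σ' (algebraMap (AlgebraicClosure F) (AlgebraicClosure (AlgebraicClosure F)) x) =
      algebraMap (AlgebraicClosure F) (AlgebraicClosure (AlgebraicClosure F)) (σ • x))
    (P : W.geomPoints) :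
    W.geomPointsBaseChangeEquiv (σ • P) =
      mapPoint σ'.toRingHom (map_baseChange_baseChange_eq W σ σ' hσ') (W.geomPointsBaseChangeEquiv P) := by
  rcases P with _ | ⟨x, y, h⟩
  · rw [← Affine.Point.zero_def]
    change W.geomPointsBaseChangeEquiv (σ • (0 : W.geomPoints)) =
      mapPoint σ'.toRingHom (map_baseChange_baseChange_eq W σ σ' hσ') (W.geomPointsBaseChangeEquiv (0 : W.geomPoints))
    rw [smul_zero, map_zero]
    rfl
  · obtain ⟨h', e1⟩ : ∃ h', σ • (show W.geomPoints from Affine.Point.some x y h) =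
        (show W.geomPoints from Affine.Point.some (σ • x) (σ • y) h') := ⟨_, rfl⟩
    change W.geomPointsBaseChangeEquiv (σ • (show W.geomPoints from Affine.Point.some x y h)) =
      mapPoint σ'.toRingHom (map_baseChange_baseChange_eq W σ σ' hσ')
        (W.geomPointsBaseChangeEquiv (show W.geomPoints from Affine.Point.some x y h))
    rw [e1, geomPointsBaseChangeEquiv_apply, geomPointsBaseChangeEquiv_apply, Affine.Point.map_some, Affine.Point.map_some]
    change Affine.Point.some _ _ _ =
      Affine.Point.some (σ'.toRingHom (Algebra.ofId (AlgebraicClosure F) (AlgebraicClosure (AlgebraicClosure F)) x))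
        (σ'.toRingHom (Algebra.ofId (AlgebraicClosure F) (AlgebraicClosure (AlgebraicClosure F)) y)) _
    congr 1
    · exact (hσ' x).symm
    · exact (hσ' y).symm

end Beta

/-! ## §4 Commutation on the stabiliser from anti-commutation off it -/

section Comm

variable {G A B : Type*} [Group G] [AddCommGroup A] [DistribMulAction G A] [AddGroup B] [DistribMulAction G B]

/-- If `ψ` anti-commutes with every `τ ∈ G` moving `r` to `-r`, and ONE such `σ₀` exists, then `ψ` commutes with every `σ` fixing `r`
(`σ = (σ σ₀) σ₀⁻¹`, both factors anti-commute). [folklore] -/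
theorem smul_comm_of_forall_smul_anticomm (ψ : A →+ A) (r : B)
    (hanti : ∀ τ : G, τ • r = -r → ∀ Q : A, τ • ψ Q = -ψ (τ • Q)) (σ₀ : G) (hσ₀ : σ₀ • r = -r)
    (σ : G) (hσ : σ • r = r) (P : A) : σ • ψ P = ψ (σ • P) := by
  have hτ : (σ * σ₀) • r = -r := by rw [mul_smul, hσ₀, smul_neg, hσ]
  have hinv : σ₀⁻¹ • ψ P = -ψ (σ₀⁻¹ • P) := by
    have h := hanti σ₀ hσ₀ (σ₀⁻¹ • P)
    rw [smul_inv_smul] at h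
    have h' := congrArg (fun Q ↦ σ₀⁻¹ • Q) h
    simp only [inv_smul_smul, smul_neg] at h'
    rw [h', neg_neg]
  calc σ • ψ P = (σ * σ₀) • (σ₀⁻¹ • ψ P) := by rw [← mul_smul, mul_assoc, mul_inv_cancel, mul_one]
    _ = -((σ * σ₀) • ψ (σ₀⁻¹ • P)) := by rw [hinv, smul_neg]
    _ = ψ ((σ * σ₀) • (σ₀⁻¹ • P)) := by rw [hanti _ hτ, neg_neg]
    _ = ψ (σ • P) := by rw [← mul_smul, mul_assoc, mul_inv_cancel, mul_one]

end Comm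

/-! ## §5 The endomorphism `[√d]` in Galois-action form -/

section Main

variable {F : Type u} [Field F] [CharZero F] {W W' : WeierstrassCurve F} [hW : W.IsElliptic]

/-- **`[√d]` on `E(F̄)` over a base `F ∌ √d`.** Let `φ : W → W′` be an isogeny formula over `F` with twisting data `IsTwistBy d` (so
`W′ = W^{(d)}`, short models), `U` and `h` coprime, `r ∈ F̄` with `r² = d`, and `σ₀ ∈ Γ_F` with `σ₀ r = -r`. Then there is an additive
endomorphism `ψ` of `E(F̄)` (`ψ = β⁻¹ ∘ [√d]_{F̄} ∘ β`, `[√d]_{F̄}` the tree's `IsogenyFormula.sqrtEndo` over the base `F̄`) with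
`σ • ψ P = ψ (σ • P)` whenever `σ r = r`, `σ • ψ P = -ψ (σ • P)` whenever `σ r = -r`, and `ψ (ψ P) = -(deg U) • P`.
[cite: SilvermanAdvancedTopics1994, II §2, Prop. II.2.3.1 and Thm. II.2.2(b)] [cite: SilvermanAEC2009, Cor. III.6.3] -/
theorem exists_sqrt_endomorphism (φ : IsogenyFormula W W') {d : F} (H : φ.IsTwistBy d) (hcop : IsCoprime φ.U φ.h)
    (r : AlgebraicClosure F) (hr : r ^ 2 = algebraMap F (AlgebraicClosure F) d) (hr0 : r ≠ 0)
    (σ₀ : absoluteGaloisGroup F) (hσ₀ : σ₀ • r = -r) :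
    ∃ ψ : W.geomPoints →+ W.geomPoints,
      (∀ σ : absoluteGaloisGroup F, σ • r = r → ∀ P : W.geomPoints, σ • ψ P = ψ (σ • P)) ∧
      (∀ σ : absoluteGaloisGroup F, σ • r = -r → ∀ P : W.geomPoints, σ • ψ P = -ψ (σ • P)) ∧
      (∀ P : W.geomPoints, ψ (ψ P) = -((φ.U.natDegree : ℤ) • P)) := by
  -- notation: `Ω = F̄`, `Ωb = \overline{F̄}`
  haveI : CharZero (AlgebraicClosure F) := charZero_of_injective_algebraMap (algebraMap F _).injective
  haveI hWΩ : (W.baseChange (AlgebraicClosure F)).IsElliptic := inferInstanceAs (W.map (algebraMap F (AlgebraicClosure F))).IsElliptic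
  let φΩ : IsogenyFormula (W.baseChange (AlgebraicClosure F)) (W'.baseChange (AlgebraicClosure F)) :=
    φ.map (algebraMap F (AlgebraicClosure F)) (algebraMap F (AlgebraicClosure F)).injective
  have HΩ : φΩ.IsTwistBy (algebraMap F (AlgebraicClosure F) d) := isTwistBy_map φ H _ (algebraMap F (AlgebraicClosure F)).injective
  let χ : Isogeny (W.baseChange (AlgebraicClosure F)) (W.baseChange (AlgebraicClosure F)) := φΩ.sqrtEndo HΩ r hr hr0
  let e := W.geomPointsBaseChangeEquiv
  let ψ : W.geomPoints →+ W.geomPoints := e.symm.toAddMonoidHom.comp (χ.toAddMonoidHom.comp e.toAddMonoidHom)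
  have hψ : ∀ P, ψ P = e.symm (χ (e P)) := fun _ ↦ rfl
  -- coprimality of `U, h` read in `\overline{F̄}`
  have hcop' : IsCoprime ((φΩ.U).map (algebraMap (AlgebraicClosure F) (AlgebraicClosure (AlgebraicClosure F))))
      ((φΩ.h).map (algebraMap (AlgebraicClosure F) (AlgebraicClosure (AlgebraicClosure F)))) := by
    have h := hcop.map (Polynomial.mapRingHom
      ((algebraMap (AlgebraicClosure F) (AlgebraicClosure (AlgebraicClosure F))).comp (algebraMap F (AlgebraicClosure F))))
    simpa only [φΩ, Polynomial.coe_mapRingHom, map_U, map_h, Polynomial.map_map] using h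
  -- anti-commutation with every `τ` moving `r`
  have hanti : ∀ τ : absoluteGaloisGroup F, τ • r = -r → ∀ Q : W.geomPoints, τ • ψ Q = -ψ (τ • Q) := by
    intro τ hτ Q
    obtain ⟨τ', hτ'⟩ := exists_ringEquiv_lift τ
    have hτr : τ' (algebraMap (AlgebraicClosure F) (AlgebraicClosure (AlgebraicClosure F)) r) =
        -algebraMap (AlgebraicClosure F) (AlgebraicClosure (AlgebraicClosure F)) r := by rw [hτ', hτ, map_neg]
    have hτU : ((φΩ.U).map (algebraMap (AlgebraicClosure F) (AlgebraicClosure (AlgebraicClosure F)))).map τ'.toRingHom =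
        (φΩ.U).map (algebraMap (AlgebraicClosure F) (AlgebraicClosure (AlgebraicClosure F))) := map_map_map_eq φ.U τ τ' hτ'
    have hτh : ((φΩ.h).map (algebraMap (AlgebraicClosure F) (AlgebraicClosure (AlgebraicClosure F)))).map τ'.toRingHom =
        (φΩ.h).map (algebraMap (AlgebraicClosure F) (AlgebraicClosure (AlgebraicClosure F))) := map_map_map_eq φ.h τ τ' hτ'
    have hτS : ((φΩ.S).map (algebraMap (AlgebraicClosure F) (AlgebraicClosure (AlgebraicClosure F)))).map τ'.toRingHom =
        (φΩ.S).map (algebraMap (AlgebraicClosure F) (AlgebraicClosure (AlgebraicClosure F))) := map_map_map_eq φ.S τ τ' hτ'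
    have key := φΩ.mapPoint_sqrtEndo HΩ r hr hr0 τ' hτr (map_baseChange_baseChange_eq W τ τ' hτ') hτU hτh hτS (e Q)
    apply e.injective
    rw [geomPointsBaseChangeEquiv_smul W τ τ' hτ', hψ, e.apply_symm_apply, map_neg, hψ, e.apply_symm_apply,
      geomPointsBaseChangeEquiv_smul W τ τ' hτ']
    exact key
  -- `ψ ∘ ψ = [-deg U]`
  have hsq : ∀ P : W.geomPoints, ψ (ψ P) = -((φ.U.natDegree : ℤ) • P) := by
    intro P
    obtain ⟨σ', hσ'⟩ := exists_ringEquiv_lift σ₀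
    have hσr : σ' (algebraMap (AlgebraicClosure F) (AlgebraicClosure (AlgebraicClosure F)) r) =
        -algebraMap (AlgebraicClosure F) (AlgebraicClosure (AlgebraicClosure F)) r := by rw [hσ', hσ₀, map_neg]
    have hσU : ((φΩ.U).map (algebraMap (AlgebraicClosure F) (AlgebraicClosure (AlgebraicClosure F)))).map σ'.toRingHom =
        (φΩ.U).map (algebraMap (AlgebraicClosure F) (AlgebraicClosure (AlgebraicClosure F))) := map_map_map_eq φ.U σ₀ σ' hσ'
    have hσh : ((φΩ.h).map (algebraMap (AlgebraicClosure F) (AlgebraicClosure (AlgebraicClosure F)))).map σ'.toRingHom =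
        (φΩ.h).map (algebraMap (AlgebraicClosure F) (AlgebraicClosure (AlgebraicClosure F))) := map_map_map_eq φ.h σ₀ σ' hσ'
    have hσS : ((φΩ.S).map (algebraMap (AlgebraicClosure F) (AlgebraicClosure (AlgebraicClosure F)))).map σ'.toRingHom =
        (φΩ.S).map (algebraMap (AlgebraicClosure F) (AlgebraicClosure (AlgebraicClosure F))) := map_map_map_eq φ.S σ₀ σ' hσ'
    have key := φΩ.sqrtEndo_comp_self HΩ r hr hr0 σ' hσr (map_baseChange_baseChange_eq W σ₀ σ' hσ') hσU hσh hσS hcop' (e P)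
    have hdeg : φΩ.U.natDegree = φ.U.natDegree := Polynomial.natDegree_map (algebraMap F (AlgebraicClosure F))
    apply e.injective
    rw [hψ, e.apply_symm_apply, hψ, e.apply_symm_apply, map_neg, map_zsmul, ← hdeg]
    exact key
  exact ⟨ψ, fun σ hσ P ↦ smul_comm_of_forall_smul_anticomm ψ r hanti σ₀ hσ₀ σ hσ P, hanti, hsq⟩

end Main

end Summit.BirchSwinnertonDyer.BirchSwinnertonDyer.Theorems.BiquadraticEisensteinDescentEisensteinHeartFlatCMInertBadKPrimeSqrtEndomorphism

end
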